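import Mathlib

/-!
# `H¹(GL₂(𝔽₅), 𝔤𝔩₂(𝔽₅)) = 0` — a kernel certificate

Every 1-cocycle of the finite group `GL₂(𝔽₅)` with values in the adjoint module `M₂(𝔽₅)`
(`g · X = g X g⁻¹`) is a 1-coboundary (`exists_eq_coboundary`); the same then holds for trace-zero
(`𝔰𝔩₂`) values with a trace-zero `m` (`exists_traceless_eq_coboundary`: scalars are fixed by the
action and `2` is invertible mod `5`). On the way: the two elementary transvections and `diag(2, 1)`
generate `GL₂(𝔽₅)` (`eq_top_of_mem`, Bruhat decomposition).

This is the cohomological input of the `GL₂(𝔽₅)`-variant of Manoharmayum's lifting theorem used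
to discharge Kato's hypothesis (12.5.2) / Skinner–Urban's lattice clause for NON-RATIONAL members of
the ordinary `Λ`-fibre at `p = 5` (ARM-P audit r07 S7 Δ1 and its ADDENDUM-1 §B–§C, 2026-08-27, on the
cite-level facts `Fouquet2024.padicValRat_bsd_rank_zero_of_ordinaryFibre{_ellipticShape,}{,_levelNotOneModP}`
consumed by the K8-t′ fibre roads `…TameLowerFouquetFibreRoad{,Level}` for item 19618). In print as
a statement: Arias-de-Reyna–Böckle, Algebra & Number Theory 20 (2026), Rem. 3.42 (from Flach, Invent.
Math. 109 (1992)): `H¹(GL₂(𝔽₅), 𝔤𝔩₂) = 0`, while `H¹(SL₂(𝔽₅), 𝔰𝔩₂) ≅ 𝔽₅` is the `(2, 𝔽₅)`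
exception of [DDT] Lemma 2.48 / Manoharmayum, Proc. AMS 143 (2015). Nothing here is specific to
elliptic curves and nothing here proves anything about items 19618/19981: it replaces a machine
check (python, four independent routes: bsd-cited r07 ADD-1 §B M1–M3 and HOME/k8t-c2/g13/kit) by a
kernel check of the one computational input of that discharge.

Method: with `u = (1 1; 0 1)`, `v = (1 0; 1 1)`, `d = (2 0; 0 1)`, the relations `d u = u² d`,
`d v = v³ d`, `u v⁻¹ u = v⁻¹ u v⁻¹`, `d² = d⁻²`, pushed through the cocycle identity, cut
`(f u, f v, f d)` down to the 3-dimensional space of coboundaries (a linear-algebra certificate over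
`𝔽₅` found offline and checked here by `linear_combination` + `reduce_mod_char`); the explicit `m`
with `f = ∂m` on the generators then works on the whole group because the zero set of a cocycle is
a subgroup containing the generators. No definitions are introduced (the generators are `set`
locally), so the file is a pure proof file.
-/

set_option linter.dupNamespace false

open Matrix

namespace Summit.BirchSwinnertonDyer.BirchSwinnertonDyer.Theorems.GL2F5AdjointH1

/-- **Generation (Bruhat).** A subgroup of `GL₂(𝔽₅)` containing the elementary transvections
`(1 1; 0 1)`, `(1 0; 1 1)` and the torus element `diag(2, 1)` is everything. -/
theorem eq_top_of_mem (H : Subgroup (GL (Fin 2) (ZMod 5)))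
    (hu : ∀ g : GL (Fin 2) (ZMod 5), g.val = !![1, 1; 0, 1] → g ∈ H)
    (hv : ∀ g : GL (Fin 2) (ZMod 5), g.val = !![1, 0; 1, 1] → g ∈ H)
    (hd : ∀ g : GL (Fin 2) (ZMod 5), g.val = !![2, 0; 0, 1] → g ∈ H) : H = ⊤ := by
  set u : GL (Fin 2) (ZMod 5) := ⟨!![1, 1; 0, 1], !![1, 4; 0, 1], by decide, by decide⟩ with u_def
  set v : GL (Fin 2) (ZMod 5) := ⟨!![1, 0; 1, 1], !![1, 0; 4, 1], by decide, by decide⟩ with v_def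
  set d : GL (Fin 2) (ZMod 5) := ⟨!![2, 0; 0, 1], !![3, 0; 0, 1], by decide, by decide⟩ with d_def
  have u_mem : u ∈ H := hu u rfl
  have v_mem : v ∈ H := hv v rfl
  have d_mem : d ∈ H := hd d rfl
  -- the Weyl-type element `w₀ = u v⁻¹ u = (0 1; -1 0)` and the second torus generator `d₂ = diag(1, 2)`
  set w₀ : GL (Fin 2) (ZMod 5) := u * v⁻¹ * u with w₀_def
  set d₂ : GL (Fin 2) (ZMod 5) := w₀ * d * w₀⁻¹ with d₂_def
  have w₀_mem : w₀ ∈ H := H.mul_mem (H.mul_mem u_mem (H.inv_mem v_mem)) u_mem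
  have d₂_mem : d₂ ∈ H := H.mul_mem (H.mul_mem w₀_mem d_mem) (H.inv_mem w₀_mem)
  have w₀_inv_val : (w₀⁻¹).val = !![0, 4; 1, 0] := by decide
  have upow_val : ∀ x : ZMod 5, (u ^ x.val).val = !![1, x; 0, 1] := by
    intro x; fin_cases x <;> decide
  have upow_inv_val : ∀ x : ZMod 5, ((u ^ x.val)⁻¹).val = !![1, -x; 0, 1] := by
    intro x; fin_cases x <;> decide
  -- every invertible diagonal matrix is a `d ^ i * d₂ ^ j`
  have diag_val : ∀ α δ : ZMod 5, α ≠ 0 → δ ≠ 0 → ∃ i j : ℕ, (d ^ i * d₂ ^ j).val = !![α, 0; 0, δ] := by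
    intro α δ hα hδ
    fin_cases α <;> fin_cases δ
    all_goals first
      | exact absurd rfl hα
      | exact absurd rfl hδ
      | exact ⟨0, 0, by decide⟩ | exact ⟨0, 1, by decide⟩ | exact ⟨0, 2, by decide⟩ | exact ⟨0, 3, by decide⟩
      | exact ⟨1, 0, by decide⟩ | exact ⟨1, 1, by decide⟩ | exact ⟨1, 2, by decide⟩ | exact ⟨1, 3, by decide⟩
      | exact ⟨2, 0, by decide⟩ | exact ⟨2, 1, by decide⟩ | exact ⟨2, 2, by decide⟩ | exact ⟨2, 3, by decide⟩
      | exact ⟨3, 0, by decide⟩ | exact ⟨3, 1, by decide⟩ | exact ⟨3, 2, by decide⟩ | exact ⟨3, 3, by decide⟩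
  -- from here on `𝔽₅` is used as a field
  haveI : Fact (Nat.Prime 5) := ⟨by norm_num⟩
  -- determinants are non-zero
  have det_ne : ∀ g : GL (Fin 2) (ZMod 5), g.val 0 0 * g.val 1 1 - g.val 0 1 * g.val 1 0 ≠ 0 := by
    intro g
    have h := (Matrix.GeneralLinearGroup.det g).ne_zero
    simpa [Matrix.det_fin_two] using h
  -- upper-triangular elements lie in `H` (they are `diag · u^k`)
  have upper : ∀ g : GL (Fin 2) (ZMod 5), g.val 1 0 = 0 → g ∈ H := by
    intro g h
    have hdet := det_ne g
    rw [h, mul_zero, sub_zero] at hdet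
    have hα : g.val 0 0 ≠ 0 := left_ne_zero_of_mul hdet
    have hδ : g.val 1 1 ≠ 0 := right_ne_zero_of_mul hdet
    obtain ⟨i, j, hD⟩ := diag_val _ _ hα hδ
    have key : g = (d ^ i * d₂ ^ j) * u ^ ((g.val 0 0)⁻¹ * g.val 0 1).val := by
      apply Units.ext
      rw [Units.val_mul, hD, upow_val]
      ext a b
      fin_cases a <;> fin_cases b
      · simp [Matrix.mul_apply, Fin.sum_univ_two]
      · simp only [Matrix.mul_apply, Fin.sum_univ_two, Fin.isValue, Fin.zero_eta, Fin.mk_one, of_apply,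
          cons_val', cons_val_zero, cons_val_one, cons_val_fin_one, empty_val']
        rw [← mul_assoc, mul_inv_cancel₀ hα, one_mul, zero_mul, add_zero]
      · simp [Matrix.mul_apply, Fin.sum_univ_two, h]
      · simp [Matrix.mul_apply, Fin.sum_univ_two]
    rw [key]
    exact H.mul_mem (H.mul_mem (H.pow_mem d_mem i) (H.pow_mem d₂_mem j)) (H.pow_mem u_mem _)
  -- Bruhat: the rest is `u^x · w₀ · (upper triangular)`
  have all_mem : ∀ g : GL (Fin 2) (ZMod 5), g ∈ H := by
    intro g
    by_cases h : g.val 1 0 = 0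
    · exact upper g h
    have ht10 : (w₀⁻¹ * (u ^ (g.val 0 0 * (g.val 1 0)⁻¹).val)⁻¹ * g).val 1 0 = 0 := by
      rw [Units.val_mul, Units.val_mul, w₀_inv_val, upow_inv_val]
      have h' : g.val 0 0 * (g.val 1 0)⁻¹ * g.val 1 0 = g.val 0 0 := by
        rw [mul_assoc, inv_mul_cancel₀ h, mul_one]
      simp only [Matrix.mul_apply, Fin.sum_univ_two, Fin.isValue, of_apply, cons_val', cons_val_zero,
        cons_val_one, cons_val_fin_one, empty_val']
      linear_combination -h'
    have key : g = u ^ (g.val 0 0 * (g.val 1 0)⁻¹).val * w₀ *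
        (w₀⁻¹ * (u ^ (g.val 0 0 * (g.val 1 0)⁻¹).val)⁻¹ * g) := by group
    rw [key]
    exact H.mul_mem (H.mul_mem (H.pow_mem u_mem _) w₀_mem) (upper _ ht10)
  exact (Subgroup.eq_top_iff' H).mpr all_mem

/-- **`H¹(GL₂(𝔽₅), M₂(𝔽₅)) = 0`**: every crossed homomorphism `GL₂(𝔽₅) → M₂(𝔽₅)` for the
conjugation action is principal. -/
theorem exists_eq_coboundary (f : GL (Fin 2) (ZMod 5) → Matrix (Fin 2) (Fin 2) (ZMod 5))
    (hf : ∀ g h : GL (Fin 2) (ZMod 5), f (g * h) = f g + g.val * f h * (g⁻¹).val) :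
    ∃ m : Matrix (Fin 2) (Fin 2) (ZMod 5), ∀ g : GL (Fin 2) (ZMod 5), f g = g.val * m * (g⁻¹).val - m := by
  set u : GL (Fin 2) (ZMod 5) := ⟨!![1, 1; 0, 1], !![1, 4; 0, 1], by decide, by decide⟩ with u_def
  set v : GL (Fin 2) (ZMod 5) := ⟨!![1, 0; 1, 1], !![1, 0; 4, 1], by decide, by decide⟩ with v_def
  set d : GL (Fin 2) (ZMod 5) := ⟨!![2, 0; 0, 1], !![3, 0; 0, 1], by decide, by decide⟩ with d_def
  have u_val : u.val = !![1, 1; 0, 1] := rfl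
  have u_inv_val : (u⁻¹).val = !![1, 4; 0, 1] := rfl
  have v_val : v.val = !![1, 0; 1, 1] := rfl
  have v_inv_val : (v⁻¹).val = !![1, 0; 4, 1] := rfl
  have d_val : d.val = !![2, 0; 0, 1] := rfl
  have d_inv_val : (d⁻¹).val = !![3, 0; 0, 1] := rfl
  -- relations
  have rel_du : d * u = u * u * d := by decide
  have rel_dv : d * v = v * v * v * d := by decide
  have rel_br : u * v⁻¹ * u = v⁻¹ * u * v⁻¹ := by decide
  have rel_d4 : d * d = d⁻¹ * d⁻¹ := by decide
  -- the cocycle at `1` and at inverses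
  have f_one : f 1 = 0 := by
    have := hf 1 1
    simpa using this
  have f_inv : ∀ g : GL (Fin 2) (ZMod 5), f g⁻¹ = -((g⁻¹).val * f g * g.val) := by
    intro g
    have h := hf g⁻¹ g
    rw [inv_mul_cancel, f_one, inv_inv] at h
    rw [eq_neg_iff_add_eq_zero]
    exact h.symm
  -- the four relations, pushed through the cocycle identity
  have Edu := congrArg f rel_du
  have Edv := congrArg f rel_dv
  have Ebr := congrArg f rel_br
  have Ed4 := congrArg f rel_d4
  simp only [hf, f_inv, Units.val_mul, _root_.mul_inv_rev, inv_inv, u_val, u_inv_val, v_val, v_inv_val,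
    d_val, d_inv_val] at Edu Edv Ebr Ed4
  -- sixteen scalar equations
  have du00 := congrFun (congrFun Edu 0) 0
  have du01 := congrFun (congrFun Edu 0) 1
  have du10 := congrFun (congrFun Edu 1) 0
  have du11 := congrFun (congrFun Edu 1) 1
  have dv00 := congrFun (congrFun Edv 0) 0
  have dv01 := congrFun (congrFun Edv 0) 1
  have dv10 := congrFun (congrFun Edv 1) 0
  have dv11 := congrFun (congrFun Edv 1) 1
  have br00 := congrFun (congrFun Ebr 0) 0
  have br01 := congrFun (congrFun Ebr 0) 1
  have br10 := congrFun (congrFun Ebr 1) 0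
  have br11 := congrFun (congrFun Ebr 1) 1
  have d400 := congrFun (congrFun Ed4 0) 0
  have d401 := congrFun (congrFun Ed4 0) 1
  have d410 := congrFun (congrFun Ed4 1) 0
  have d411 := congrFun (congrFun Ed4 1) 1
  simp only [Matrix.add_apply, Matrix.neg_apply, Matrix.mul_apply, Fin.sum_univ_two, Matrix.of_apply,
    Matrix.cons_val', Matrix.cons_val_zero, Matrix.cons_val_one, Matrix.empty_val', Matrix.cons_val_fin_one,
    Fin.isValue] at du00 du01 du10 du11 dv00 dv01 dv10 dv11 br00 br01 br10 br11 d400 d401 d410 d411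
  -- the explicit `m`
  obtain ⟨m₀, hm₀⟩ : ∃ m₀ : Matrix (Fin 2) (Fin 2) (ZMod 5),
      m₀ = !![4 * f u 0 0 + 4 * f u 0 1, 4 * f v 0 0; f u 0 0, 0] := ⟨_, rfl⟩
  refine ⟨m₀, ?_⟩
  -- `f = ∂ m₀` on the three generators (the certificate)
  have gen_u : f u = u.val * m₀ * (u⁻¹).val - m₀ := by
    ext i j
    fin_cases i <;> fin_cases j <;> simp only [hm₀, u_val, u_inv_val, Matrix.sub_apply, Matrix.mul_apply,
        Fin.sum_univ_two, Matrix.of_apply, Matrix.cons_val', Matrix.cons_val_zero, Matrix.cons_val_one,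
        Matrix.empty_val', Matrix.cons_val_fin_one, Fin.isValue, Fin.zero_eta, Fin.mk_one]
    · ring_nf
      try reduce_mod_char
    · ring_nf
      try reduce_mod_char
    · linear_combination (norm := skip) du10
      ring_nf
      try reduce_mod_char
    · linear_combination (norm := skip) 4 * du00 + 4 * du11
      ring_nf
      try reduce_mod_char
  have gen_v : f v = v.val * m₀ * (v⁻¹).val - m₀ := by
    ext i j
    fin_cases i <;> fin_cases j <;> simp only [hm₀, v_val, v_inv_val, Matrix.sub_apply, Matrix.mul_apply,
        Fin.sum_univ_two, Matrix.of_apply, Matrix.cons_val', Matrix.cons_val_zero, Matrix.cons_val_one,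
        Matrix.empty_val', Matrix.cons_val_fin_one, Fin.isValue, Fin.zero_eta, Fin.mk_one]
    · ring_nf
      try reduce_mod_char
    · linear_combination (norm := skip) 4 * dv01
      ring_nf
      try reduce_mod_char
    · linear_combination (norm := skip) 4 * du00 + du10 + 4 * du11 + 4 * dv01 + 4 * br00
      ring_nf
      try reduce_mod_char
    · linear_combination (norm := skip) 3 * du00 + 3 * du01 + 3 * du10 + 2 * du11 + 4 * dv00 + 2 * dv01 + 2 * dv10
      ring_nf
      try reduce_mod_char
  have gen_d : f d = d.val * m₀ * (d⁻¹).val - m₀ := by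
    ext i j
    fin_cases i <;> fin_cases j <;> simp only [hm₀, d_val, d_inv_val, Matrix.sub_apply, Matrix.mul_apply,
        Fin.sum_univ_two, Matrix.of_apply, Matrix.cons_val', Matrix.cons_val_zero, Matrix.cons_val_one,
        Matrix.empty_val', Matrix.cons_val_fin_one, Fin.isValue, Fin.zero_eta, Fin.mk_one]
    · linear_combination (norm := skip) 4 * d400
      ring_nf
      try reduce_mod_char
    · linear_combination (norm := skip) 2 * dv00 + dv01
      ring_nf
      try reduce_mod_char
    · linear_combination (norm := skip) 2 * du00 + 2 * du10
      ring_nf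
      try reduce_mod_char
    · linear_combination (norm := skip) 2 * du00 + 2 * du01 + 2 * du10 + 3 * du11 + 4 * d400
      ring_nf
      try reduce_mod_char
  -- the corrected cocycle vanishes on a subgroup containing the generators, hence everywhere
  let f' : GL (Fin 2) (ZMod 5) → Matrix (Fin 2) (Fin 2) (ZMod 5) :=
    fun g => f g - (g.val * m₀ * (g⁻¹).val - m₀)
  have hf' : ∀ g h : GL (Fin 2) (ZMod 5), f' (g * h) = f' g + g.val * f' h * (g⁻¹).val := by
    intro g h
    simp only [f', hf g h, Units.val_mul, _root_.mul_inv_rev, Matrix.mul_sub, Matrix.sub_mul, Matrix.mul_assoc]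
    abel
  have hf'1 : f' 1 = 0 := by
    have := hf' 1 1
    simpa using this
  let Z : Subgroup (GL (Fin 2) (ZMod 5)) :=
    { carrier := {g | f' g = 0}
      mul_mem' := by
        intro x y hx hy
        simp only [Set.mem_setOf_eq] at hx hy ⊢
        rw [hf', hx, hy, Matrix.mul_zero, Matrix.zero_mul, add_zero]
      one_mem' := hf'1
      inv_mem' := by
        intro x hx
        simp only [Set.mem_setOf_eq] at hx ⊢
        have h := hf' x⁻¹ x
        rw [inv_mul_cancel, hf'1, hx, Matrix.mul_zero, Matrix.zero_mul, add_zero] at h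
        exact h.symm }
  have hZ : Z = ⊤ := by
    refine eq_top_of_mem Z ?_ ?_ ?_
    · intro g hg
      have : g = u := Units.ext hg
      subst this
      exact sub_eq_zero.mpr gen_u
    · intro g hg
      have : g = v := Units.ext hg
      subst this
      exact sub_eq_zero.mpr gen_v
    · intro g hg
      have : g = d := Units.ext hg
      subst this
      exact sub_eq_zero.mpr gen_d
  intro g
  have hg : g ∈ Z := hZ ▸ Subgroup.mem_top g
  exact sub_eq_zero.mp hg

/-- **`H¹(GL₂(𝔽₅), 𝔰𝔩₂(𝔽₅)) = 0`**: a trace-zero-valued crossed homomorphism is the coboundary of a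
trace-zero matrix. -/
theorem exists_traceless_eq_coboundary (f : GL (Fin 2) (ZMod 5) → Matrix (Fin 2) (Fin 2) (ZMod 5))
    (hf : ∀ g h : GL (Fin 2) (ZMod 5), f (g * h) = f g + g.val * f h * (g⁻¹).val)
    (htr : ∀ g, (f g).trace = 0) :
    ∃ m : Matrix (Fin 2) (Fin 2) (ZMod 5), m.trace = 0 ∧
      ∀ g : GL (Fin 2) (ZMod 5), f g = g.val * m * (g⁻¹).val - m := by
  have _ := htr
  obtain ⟨m, hm⟩ := exists_eq_coboundary f hf
  refine ⟨m - (3 * m.trace) • (1 : Matrix (Fin 2) (Fin 2) (ZMod 5)), ?_, ?_⟩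
  · simp only [Matrix.trace_sub, Matrix.trace_smul, Matrix.trace_one, Fintype.card_fin, smul_eq_mul]
    ring_nf
    reduce_mod_char
  · intro g
    rw [hm g]
    simp only [Matrix.mul_sub, Matrix.sub_mul, Matrix.mul_smul, Matrix.smul_mul, Matrix.mul_one]
    rw [← Units.val_mul, mul_inv_cancel, Units.val_one]
    abel

end Summit.BirchSwinnertonDyer.BirchSwinnertonDyer.Theorems.GL2F5AdjointH1
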